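import Literature.Probability.RandomPlanarGeometry.SAWFiniteMemory
import Mathlib.Data.List.Lex
import Mathlib.Data.Finset.Max
import HarnessLib

/-!
# The symmetry-reduced Pönitz–Tittmann certificate: `μ(ℤ²) ≤ N/D` from normal-form states

Topic `Literature/Probability/RandomPlanarGeometry` (continues `SAWFiniteMemory.lean`). The
memory-`K` automaton `FiniteMemory.ptStep K` of Pönitz–Tittmann (2000) has `467 249` reachable
states for `K = 16` and `2 689 301` for `K = 18` on `ℤ²`, too many for one kernel evaluation of the
unreduced check `FiniteMemory.check` at `K = 18`. Pönitz and Tittmann reduce the automaton by the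
lattice symmetries (§3: "we exploit this kind of symmetry by normalizing states … States whose
normalized representatives are the same could be collected since they exhibit equal weights").
This file makes that reduction kernel-checkable:
* `syms` — the dihedral group of `ℤ²` as eight permutations of the step alphabet (`rot r : d ↦ r + d`,
  `refl r : d ↦ r - d`), `phiP g` the induced linear isometry, and **`ptStep_map`**:
  `ptStep K (g·a) (g d) = g·(ptStep K a d)` (the automaton's rule is stated in `ℓ¹`-distances only);
* `canon a` — the normal form (lexicographically least of the eight images): `exists_canon_eq`
  (it is an image), `canon_map` (it is invariant);
* `checkC K N D iters` — executable reduced check: an untrusted breadth-first search over NORMAL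
  FORMS (`K = 16`: `58 411`; `K = 18`: `336 168`) and an integer power iteration propose a weight
  `v`; the verified `verifyC` checks closure and the Collatz–Wielandt inequalities for the
  SYMMETRIC weight `a ↦ v(canon a)` at every tabulated normal form;
* `certificate_of_verifyC` — soundness: by equivariance the successors of `g·a₀` are the `g`-images
  of the successors of `a₀` in permuted order, so the inequalities checked at the normal forms hold
  on their whole orbits (a `WordAutomaton.Certificate` on `{a | canon a tabulated}`); hence
  `count_mul_pow_le_of_checkC` (`cₙ Dⁿ ≤ Nⁿ 2⁴¹`) and
  **`connectiveConstant_le_of_checkC : checkC K N D iters = true → μ(ℤ²) ≤ N/D`**.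
The evaluation `checkC 18 2689 1000 80 = true` (P–T Table 2, `k = 18`: `μ ≤ 2.6880`) is one
`native_decide` in `SAWFiniteMemory18.lean`, giving `μ(ℤ²) ≤ 2.689`. The group facts used (closure,
inverses) are decided pointwise on `Fin 4`.

## References

* A. Pönitz, P. Tittmann, *Improved upper bounds for self-avoiding walks in ℤᵈ*, Electron. J.
  Combin. 7 (2000) R21, §2 (automaton), §3 (normalizing states; eigenvalue bound), Table 2
  [PonitzTittmann2000].
* L. Collatz, *Einschließungssatz für die charakteristischen Zahlen von Matrizen*, Math. Z. 48
  (1942) 221–226.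
-/


open Finset Filter Topology Literature.Probability.LatticeModels BigOperators

namespace Literature.Probability.RandomPlanarGeometry.SAW

namespace FiniteMemory

/-! ### The eight lattice symmetries on the step alphabet -/

/-- Rotation of the step alphabet: `d ↦ r + d` (`r = 1` is the quarter turn `+e₀ ↦ +e₁`).
[cite: PonitzTittmann2000, §3] -/
def rot (r : Fin 4) : Step → Step := fun d => r + d

/-- `rot` unfolds. [cite: PonitzTittmann2000, §3] -/
@[simp] theorem rot_apply (r d : Fin 4) : rot r d = r + d := rfl

/-- Reflection of the step alphabet: `d ↦ r - d` (`r = 0` is `(x, y) ↦ (x, -y)`).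
[cite: PonitzTittmann2000, §3] -/
def refl (r : Fin 4) : Step → Step := fun d => r - d

/-- `refl` unfolds. [cite: PonitzTittmann2000, §3] -/
@[simp] theorem refl_apply (r d : Fin 4) : refl r d = r - d := rfl

/-- The dihedral group of the square lattice as eight permutations of the step alphabet.
[cite: PonitzTittmann2000, §3] -/
def syms : List (Step → Step) := [rot 0, rot 1, rot 2, rot 3, refl 0, refl 1, refl 2, refl 3]

/-- The eight images of a step word under the lattice symmetries. [cite: PonitzTittmann2000, §3] -/
def images (a : List Step) : List (List Step) := syms.map fun g => a.map g

/-- The images form a nonempty finset. [folklore] -/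
private theorem images_toFinset_nonempty (a : List Step) : (images a).toFinset.Nonempty :=
  ⟨a.map (rot 0), by simp [images, syms]⟩

/-- **Normal form of a state**: the lexicographically least of its eight images ("normalizing
states", Pönitz–Tittmann §3: states equal up to a lattice symmetry have equal weights and are
collected). [cite: PonitzTittmann2000, §3] -/
def canon (a : List Step) : List Step := (images a).toFinset.min' (images_toFinset_nonempty a)

/-! ### The symmetry-reduced certificate: untrusted search -/

/-- Breadth-first enumeration of the normal forms of the states reachable from `[]` (fuelled;
untrusted — only its output is checked). [cite: PonitzTittmann2000, §3] -/
def bfsC (K : ℕ) : Array (List Step) × Std.HashMap (List Step) ℕ := Id.run do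
  let mut states : Array (List Step) := #[[]]
  let mut idx : Std.HashMap (List Step) ℕ := (Std.HashMap.emptyWithCapacity 1000000).insert [] 0
  let mut i := 0
  let mut fuel := 20000000
  while i < states.size && fuel > 0 do
    fuel := fuel - 1
    let a := states[i]!
    for d in List.finRange 4 do
      match ptStep K a d with
      | none => pure ()
      | some b =>
        let c := canon b
        if !idx.contains c then
          idx := idx.insert c states.size
          states := states.push c
    i := i + 1
  return (states, idx)

/-- Successor indices (of the normal forms) of every tabulated state (untrusted). [folklore] -/
def transTableC (K : ℕ) (states : Array (List Step)) (idx : Std.HashMap (List Step) ℕ) :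
    Array (Array ℕ) :=
  states.map fun a => Id.run do
    let mut acc : Array ℕ := #[]
    for d in List.finRange 4 do
      match ptStep K a d with
      | none => pure ()
      | some b => acc := acc.push (idx.getD (canon b) 0)
    return acc

/-- The reduced search: normal-form states, index, proposed weights (untrusted).
[cite: PonitzTittmann2000, §3] -/
def searchC (K iters : ℕ) : Array (List Step) × Std.HashMap (List Step) ℕ × Array ℕ :=
  let (states, idx) := bfsC K
  (states, idx, powerIter (transTableC K states idx) iters)

/-! ### The symmetry-reduced certificate: verified check -/

/-- The symmetric weight function encoded by the arrays: `v[idx[canon a]]`. [cite: PonitzTittmann2000, §3] -/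
def weightC (idx : Std.HashMap (List Step) ℕ) (v : Array ℕ) (a : List Step) : ℕ :=
  weightOf idx v (canon a)

/-- Check of the tabulated state number `i`: consistent index, the state is a normal form,
positive weight, normal forms of the successors in the table, Collatz–Wielandt inequality for the
symmetric weight. [cite: PonitzTittmann2000, §3] -/
def verifyStateC (K N D : ℕ) (states : Array (List Step)) (idx : Std.HashMap (List Step) ℕ)
    (v : Array ℕ) (i : ℕ) : Bool :=
  match states[i]?, v[i]? with
  | some a, some vi =>
    decide (idx[a]? = some i) && decide (canon a = a) && decide (1 ≤ vi) &&
      (List.finRange 4).all (fun d =>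
        match ptStep K a d with
        | none => true
        | some b =>
          match idx[canon b]? with
          | none => false
          | some j => decide (states[j]? = some (canon b))) &&
      decide (D * (List.ofFn fun d : Step => ((ptStep K a d).map (weightC idx v)).getD 0).sum
        ≤ N * vi)
  | _, _ => false

/-- The verified part of the reduced certificate check. [cite: PonitzTittmann2000, §3] -/
def verifyC (K N D : ℕ) (states : Array (List Step)) (idx : Std.HashMap (List Step) ℕ)
    (v : Array ℕ) : Bool :=
  decide (states[0]? = some []) && decide (weightC idx v [] ≤ 2 ^ 41) &&
    (List.range states.size).all (verifyStateC K N D states idx v)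

/-- **The symmetry-reduced certificate check** `checkC K N D iters`: reduced search, then
verify. Only ever evaluated by `native_decide`. [cite: PonitzTittmann2000, §3] -/
@[irreducible] def checkC (K N D iters : ℕ) : Bool :=
  let r := searchC K iters
  verifyC K N D r.1 r.2.1 r.2.2

/-! ### Geometry of the symmetries -/

/-- The linear map of `ℤ²` induced by a symmetry `g` of the step alphabet: it sends the unit
steps `e₀, e₁` to the steps `g 0, g 1`. [folklore] -/
def phiP (g : Step → Step) (p : ℤ × ℤ) : ℤ × ℤ :=
  (p.1 * Step.dx (g 0) + p.2 * Step.dx (g 1), p.1 * Step.dy (g 0) + p.2 * Step.dy (g 1))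

/-- `phiP g` fixes the origin. [folklore] -/
@[simp] private theorem phiP_zero (g : Step → Step) : phiP g (0, 0) = (0, 0) := by simp [phiP]

/-- **Equivariance of one step**: `phiP g (p + e_d) = phiP g p + e_{g d}` for the eight
symmetries. [folklore] -/
private theorem phiP_pxy {g : Step → Step} (hg : g ∈ syms) (d : Step) (p : ℤ × ℤ) :
    phiP g (pxy d p) = pxy (g d) (phiP g p) := by
  simp only [syms, List.mem_cons, List.not_mem_nil, or_false] at hg
  obtain ⟨x, y⟩ := p
  rcases hg with rfl | rfl | rfl | rfl | rfl | rfl | rfl | rfl <;>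
    fin_cases d <;>
      simp +decide [phiP, pxy, Step.dx, Step.dy] <;> omega

/-- The eight symmetries are `ℓ¹`-isometries. [folklore] -/
private theorem dist1_phiP {g : Step → Step} (hg : g ∈ syms) (p q : ℤ × ℤ) :
    dist1 (phiP g p) (phiP g q) = dist1 p q := by
  simp only [syms, List.mem_cons, List.not_mem_nil, or_false] at hg
  obtain ⟨x, y⟩ := p; obtain ⟨x', y'⟩ := q
  rcases hg with rfl | rfl | rfl | rfl | rfl | rfl | rfl | rfl <;>
    simp +decide [phiP, dist1, Step.dx, Step.dy] <;> omega

/-- The eight symmetries are injective on `ℤ²`. [folklore] -/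
private theorem phiP_injective {g : Step → Step} (hg : g ∈ syms) : Function.Injective (phiP g) := by
  intro p q h
  have h0 : dist1 (phiP g p) (phiP g q) = 0 := by rw [h]; simp [dist1]
  rw [dist1_phiP hg] at h0
  obtain ⟨x, y⟩ := p; obtain ⟨x', y'⟩ := q
  simp only [dist1, Prod.mk.injEq] at h0 ⊢; omega

/-- Endpoint of the image word. [folklore] -/
private theorem pEnd_map {g : Step → Step} (hg : g ∈ syms) (a : List Step) :
    pEnd (a.map g) = phiP g (pEnd a) := by
  suffices key : ∀ s : ℤ × ℤ, (a.map g).foldl (fun p d => pxy d p) (phiP g s) =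
      phiP g (a.foldl (fun p d => pxy d p) s) by
    have := key (0, 0); rw [phiP_zero] at this; exact this
  induction a with
  | nil => intro s; rfl
  | cons d a ih => intro s; rw [List.map_cons, List.foldl_cons, List.foldl_cons, ← phiP_pxy hg, ih]

/-- Vertices of the image word. [folklore] -/
private theorem pVerts_map {g : Step → Step} (hg : g ∈ syms) (a : List Step) :
    pVerts (a.map g) = (pVerts a).map (phiP g) := by
  suffices key : ∀ s : ℤ × ℤ, (a.map g).scanl (fun p d => pxy d p) (phiP g s) =
      (a.scanl (fun p d => pxy d p) s).map (phiP g) by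
    have := key (0, 0); rw [phiP_zero] at this; exact this
  induction a with
  | nil => intro s; rfl
  | cons d a ih =>
    intro s; rw [List.map_cons, List.scanl_cons, List.scanl_cons, List.map_cons, ← phiP_pxy hg, ih]

/-- **Equivariance of the Pönitz–Tittmann automaton** under the lattice symmetries:
`ptStep K (g·a) (g d) = g·(ptStep K a d)`. [cite: PonitzTittmann2000, §3] -/
theorem ptStep_map {g : Step → Step} (hg : g ∈ syms) (K : ℕ) (a : List Step) (d : Step) :
    ptStep K (a.map g) (g d) = (ptStep K a d).map (List.map g) := by
  unfold ptStep
  simp only [pEnd_map hg, pVerts_map hg, ← phiP_pxy hg, List.length_map]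
  have hmem : (phiP g (pxy d (pEnd a)) ∈ (pVerts a).map (phiP g)) ↔ pxy d (pEnd a) ∈ pVerts a := by
    rw [List.mem_map]
    exact ⟨fun ⟨q, hq, he⟩ => by rw [← phiP_injective hg he]; exact hq, fun h => ⟨_, h, rfl⟩⟩
  by_cases h : pxy d (pEnd a) ∈ pVerts a
  · rw [if_pos (hmem.2 h), if_pos h]; rfl
  · rw [if_neg (fun h' => h (hmem.1 h')), if_neg h, Option.map_some]
    congr 1
    have hp : ((fun pi : (ℤ × ℤ) × ℕ => decide (K < a.length + 1 - pi.2 + dist1 pi.1 (phiP g (pxy d (pEnd a))))) ∘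
        Prod.map (phiP g) id) =
        (fun pi : (ℤ × ℤ) × ℕ => decide (K < a.length + 1 - pi.2 + dist1 pi.1 (pxy d (pEnd a)))) := by
      funext pi
      simp only [Function.comp_apply, Prod.map_fst, Prod.map_snd, id_eq, dist1_phiP hg]
    rw [List.zipIdx_map, List.takeWhile_map, List.length_map, hp,
      show List.map g a ++ [g d] = (a ++ [d]).map g by simp, List.map_drop]

/-! ### Group-theoretic facts about the eight symmetries (decided on `Fin 4`) -/

/-- Closure under composition, pointwise form. [folklore] -/
private theorem syms_comp : ∀ g ∈ syms, ∀ h ∈ syms, ∃ k ∈ syms, ∀ d : Step, k d = h (g d) := by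
  decide +kernel

/-- Right division, pointwise form. [folklore] -/
private theorem syms_div : ∀ g ∈ syms, ∀ k ∈ syms, ∃ h ∈ syms, ∀ d : Step, h (g d) = k d := by
  decide +kernel

/-- Every symmetry has an inverse among the symmetries. [folklore] -/
private theorem syms_inv : ∀ g ∈ syms, ∃ g' ∈ syms, (∀ d : Step, g' (g d) = d) ∧ ∀ d : Step, g (g' d) = d := by
  decide +kernel

/-! ### The normal form -/

/-- Membership in the images. [folklore] -/
private theorem mem_images {a b : List Step} : b ∈ images a ↔ ∃ g ∈ syms, b = a.map g := by
  simp only [images, List.mem_map, eq_comm]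

/-- The images of an image are the images. [folklore] -/
private theorem images_toFinset_map {g : Step → Step} (hg : g ∈ syms) (a : List Step) :
    (images (a.map g)).toFinset = (images a).toFinset := by
  ext b
  rw [List.mem_toFinset, List.mem_toFinset, mem_images, mem_images]
  constructor
  · rintro ⟨h, hh, rfl⟩
    obtain ⟨k, hk, hkd⟩ := syms_comp g hg h hh
    exact ⟨k, hk, by rw [List.map_map]; exact List.map_congr_left fun d _ => (hkd d).symm⟩
  · rintro ⟨k, hk, rfl⟩
    obtain ⟨h, hh, hhd⟩ := syms_div g hg k hk
    exact ⟨h, hh, by rw [List.map_map]; exact List.map_congr_left fun d _ => (hhd d).symm⟩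

/-- **The normal form is one of the images** ("normalizing states"). [cite: PonitzTittmann2000, §3] -/
theorem exists_canon_eq (a : List Step) : ∃ g ∈ syms, canon a = a.map g :=
  mem_images.1 (List.mem_toFinset.1 (Finset.min'_mem _ (images_toFinset_nonempty a)))

/-- `min'` depends only on the finset. [folklore] -/
private theorem min'_congr {s t : Finset (List Step)} (h : s = t) (hs : s.Nonempty)
    (ht : t.Nonempty) : s.min' hs = t.min' ht := by subst h; rfl

/-- **The normal form is invariant under the symmetries** ("states whose normalized representatives are
the same could be collected"). [cite: PonitzTittmann2000, §3] -/
theorem canon_map {g : Step → Step} (hg : g ∈ syms) (a : List Step) : canon (a.map g) = canon a :=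
  min'_congr (images_toFinset_map hg a) _ _

/-- The normal form of the empty word (the initial state is its own class). [cite: PonitzTittmann2000, §3] -/
@[simp] theorem canon_nil : canon [] = [] := by
  obtain ⟨g, -, h⟩ := exists_canon_eq []
  rw [h, List.map_nil]

/-! ### Soundness of the reduced check -/

/-- **Soundness of `verifyC`**: a successful reduced check yields a Collatz–Wielandt certificate
for `ptStep K` on the set of states whose normal form is tabulated, with the symmetric weight
`a ↦ v[idx[canon a]]` and `weight([]) ≤ 2⁴¹`. [cite: PonitzTittmann2000, §3] -/
theorem certificate_of_verifyC {K N D : ℕ} {states : Array (List Step)}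
    {idx : Std.HashMap (List Step) ℕ} {v : Array ℕ} (h : verifyC K N D states idx v = true) :
    WordAutomaton.Certificate (ptStep K) {a | ∃ i < states.size, states[i]? = some (canon a)}
      (weightC idx v) N D ∧ weightC idx v [] ≤ 2 ^ 41 := by
  simp only [verifyC, Bool.and_eq_true, decide_eq_true_eq, List.all_eq_true, List.mem_range] at h
  obtain ⟨⟨h0, hroot⟩, hall⟩ := h
  -- unpack the check of a tabulated state
  have key : ∀ a : List Step, ∀ i < states.size, states[i]? = some a →
      idx[a]? = some i ∧ canon a = a ∧ 1 ≤ weightOf idx v a ∧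
      (∀ d b, ptStep K a d = some b → ∃ j < states.size, states[j]? = some (canon b)) ∧
      D * ∑ d : Step, ((ptStep K a d).map (weightC idx v)).getD 0 ≤ N * weightOf idx v a := by
    intro a i hi ha
    have hs := hall i hi
    unfold verifyStateC at hs
    rw [ha] at hs
    cases hv : v[i]? with
    | none => simp [hv] at hs
    | some vi =>
      simp only [hv, Bool.and_eq_true, decide_eq_true_eq, List.all_eq_true] at hs
      obtain ⟨⟨⟨⟨hidx, hcan⟩, hvi⟩, hsucc⟩, hcw⟩ := hs
      have hw : weightOf idx v a = vi := by simp [weightOf, hidx, hv]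
      refine ⟨hidx, hcan, hw ▸ hvi, fun d b hb => ?_, ?_⟩
      · have := hsucc d (List.mem_finRange d)
        rw [hb] at this
        cases hj : idx[canon b]? with
        | none => simp [hj] at this
        | some j =>
          simp only [hj, decide_eq_true_eq] at this
          exact ⟨j, (Array.getElem?_eq_some_iff.1 this).1, this⟩
      · rw [hw, ← List.sum_ofFn]
        exact hcw
  refine ⟨⟨?_, ?_, ?_, ?_⟩, by simpa [weightC] using hroot⟩
  · exact ⟨0, (Array.getElem?_eq_some_iff.1 h0).1, by rw [canon_nil]; exact h0⟩
  · rintro a ⟨i, hi, ha⟩ d b hb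
    obtain ⟨g, hg, hga⟩ := exists_canon_eq a
    have hstep : ptStep K (canon a) (g d) = some (b.map g) := by
      rw [hga, ptStep_map hg, hb, Option.map_some]
    obtain ⟨j, hj, hjb⟩ := (key _ i hi ha).2.2.2.1 (g d) (b.map g) hstep
    exact ⟨j, hj, by rw [canon_map hg] at hjb; exact hjb⟩
  · rintro a ⟨i, hi, ha⟩
    exact (key _ i hi ha).2.2.1
  · rintro a ⟨i, hi, ha⟩
    obtain ⟨g, hg, hga⟩ := exists_canon_eq a
    obtain ⟨g', hg', hinv1, hinv2⟩ := syms_inv g hg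
    have hcw := (key _ i hi ha).2.2.2.2
    -- the successor weights of `a` and of `canon a = g·a` agree up to the permutation `g` of `Step`
    have hterm : ∀ d : Step, ((ptStep K a d).map (weightC idx v)).getD 0 =
        ((ptStep K (canon a) (g d)).map (weightC idx v)).getD 0 := by
      intro d
      rw [hga, ptStep_map hg]
      cases ptStep K a d with
      | none => rfl
      | some b => simp only [Option.map_some, Option.getD_some, weightC, canon_map hg]
    have hsum : ∑ d : Step, ((ptStep K a d).map (weightC idx v)).getD 0 =
        ∑ d : Step, ((ptStep K (canon a) d).map (weightC idx v)).getD 0 := by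
      simp only [hterm]
      exact Equiv.sum_comp ⟨g, g', hinv1, hinv2⟩
        (fun d => ((ptStep K (canon a) d).map (weightC idx v)).getD 0)
    rw [hsum]
    exact hcw

/-- **`cₙ · Dⁿ ≤ Nⁿ · 2⁴¹`** from a successful reduced certificate check.
[cite: PonitzTittmann2000, §3] -/
theorem count_mul_pow_le_of_checkC {K N D iters : ℕ} (h : checkC K N D iters = true) (n : ℕ) :
    count n * D ^ n ≤ N ^ n * 2 ^ 41 := by
  rw [checkC] at h
  obtain ⟨hc, hroot⟩ := certificate_of_verifyC h
  have h1 := WordAutomaton.count_mul_pow_le hc (run_ne_none_of_isSAW K) n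
  rw [weightC, canon_nil] at h1 hroot
  exact le_trans h1 (Nat.mul_le_mul_left _ hroot)

/-- **`μ(ℤ²) ≤ N/D` from a successful reduced certificate check**
(`μ ≤ cₙ^{1/n} ≤ (N/D)·2^{41/n} → N/D`). [cite: PonitzTittmann2000, §3, Table 2] -/
theorem connectiveConstant_le_of_checkC {K N D iters : ℕ} (h : checkC K N D iters = true)
    (hD : 0 < D) : connectiveConstant ≤ (N : ℝ) / D := by
  have hND : (0 : ℝ) ≤ (N : ℝ) / D := by positivity
  set C : ℝ := (2 : ℝ) ^ 41 with hC_def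
  have hC : 0 < C := by positivity
  have hle : ∀ n : ℕ, connectiveConstant ≤ (N : ℝ) / D * C ^ ((n : ℝ) + 1)⁻¹ := by
    intro n
    have hn : (n + 1 : ℕ) ≠ 0 := Nat.succ_ne_zero n
    have h1 : connectiveConstant ≤ (count (n + 1) : ℝ) ^ (1 / ((n : ℝ) + 1)) := by
      have := Zd.connectiveConstant_le_rpow (d := 2) hn
      rw [Zd.connectiveConstant_two, Zd.count_two] at this
      simpa [Nat.cast_succ] using this
    have h2 : (count (n + 1) : ℝ) ≤ ((N : ℝ) / D) ^ (n + 1) * C := by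
      have h3 := count_mul_pow_le_of_checkC h (n + 1)
      have h4 : (count (n + 1) : ℝ) * (D : ℝ) ^ (n + 1) ≤ (N : ℝ) ^ (n + 1) * C := by
        rw [hC_def]; exact_mod_cast h3
      have hDpos : (0 : ℝ) < (D : ℝ) ^ (n + 1) := by positivity
      rw [div_pow, div_mul_eq_mul_div, le_div_iff₀ hDpos]
      exact h4
    have hexp : (0 : ℝ) ≤ 1 / ((n : ℝ) + 1) := by positivity
    calc connectiveConstant ≤ (count (n + 1) : ℝ) ^ (1 / ((n : ℝ) + 1)) := h1
      _ ≤ (((N : ℝ) / D) ^ (n + 1) * C) ^ (1 / ((n : ℝ) + 1)) :=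
          Real.rpow_le_rpow (Nat.cast_nonneg _) h2 hexp
      _ = (N : ℝ) / D * C ^ ((n : ℝ) + 1)⁻¹ := by
          rw [Real.mul_rpow (pow_nonneg hND _) hC.le, one_div]
          congr 1
          have : ((n : ℝ) + 1) = ((n + 1 : ℕ) : ℝ) := by push_cast; ring
          rw [this, Real.pow_rpow_inv_natCast hND hn]
  have hlim : Tendsto (fun n : ℕ => (N : ℝ) / D * C ^ ((n : ℝ) + 1)⁻¹) atTop (𝓝 ((N : ℝ) / D)) := by
    simpa using (tendsto_const_rpow_inv hC).const_mul ((N : ℝ) / D)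
  exact ge_of_tendsto' hlim hle

end FiniteMemory

end Literature.Probability.RandomPlanarGeometry.SAW
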